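import Summits.ValiantsHypothesis.ValiantsHypothesis.Theorems.KPlusLogSqLawValuativeDoorAPFreeLaw
import Summits.ValiantsHypothesis.ValiantsHypothesis.Theorems.KPlusLogSqLawValuativeDoorFGPlusOne

/-!
# LINE `valuative_door` (crux `WeakLifting`, stmt-ValiantsHypothesis-19561) — THE NEWTON POLYGON OF `f·g + 1` HAS AT MOST `3K − 4` EDGES
# when `f`, `g` are supported on a common `K`-set WITHOUT THREE-TERM PROGRESSIONS

HONEST FRAMING.  Helper (cell `pub-symmetroid`, seat val-sym-lift-p1 g25, 2026-08-29; `--supports 19561 --as helper`).  The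
literature-facing face of ✓ `valAPFree_unfolded` (this seat) through g24's dictionary ✓ `det_fgPencil` (letters `!![p_l, δ_{l l₀}; δ_{l l₀}, −q_l]`
on a support with `d l₀ = 0` have determinant `−(f g + 1)`, `f = Σ p_l X^{d_l}`, `g = Σ q_l X^{d_l}`): for every field `F` with a
non-archimedean absolute value `v`, every `K`-support `d` containing `0` and having NO THREE-TERM PROGRESSION, and all `f, g ∈ F[X]`
supported on `d`, the Newton polygon of `f g + 1` with respect to `v` has at most `3K − 4` edges (`npEdges_fg_add_one_le_of_apfree`) —
linear in `K`, for every residue characteristic.  CONTEXT (prose): Koiran–Portier–Tavenas–Thomassé (Found. Comput. Math. 2015, §5) ask for the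
maximal number of edges of `Newt(fg + 1)` for bivariate `f, g` with `t` monomials each; `O(t^{4/3})` is known (Eisenbrand–Pach–Rothvoß–Sopher
2008) and a linear bound is open; by ✓ `…FGPlusOne`'s reading (`F = k((Y))`, lower/upper edges) the present file gives a LINEAR bound
`2 (3K − 4) + 2` on the edges of the bivariate `Newt(fg + 1)` in the special case where the common `X`-support of `f`, `g`, `1` (size `K`)
has no three-term progression — a structural special case, not the open question, and nothing more is claimed.  No bearing on vW / vB,
`TropicalB`, `MatrixDescartes` (18050) or VP ≠ VNP.  [corollary: `valAPFree_unfolded` + `det_fgPencil` + `dominant_filter_neg`]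
-/

set_option linter.dupNamespace false
set_option autoImplicit false

namespace Summit.ValiantsHypothesis.ValiantsHypothesis.Theorems.KPlusLogSqLaw.ValDoor

open Polynomial Finset
open scoped BigOperators Classical

/-- **`Newt_v(f g + 1)` HAS AT MOST `3K − 4` EDGES ON A PROGRESSION-FREE COMMON SUPPORT.**  For a non-archimedean `v` on a field `F`,
a support `d : Fin K → ℕ` with `d l₀ = 0` and no three-term progression (`d_{l₁} + d_{l₂} = 2 d_{l₃}` only for `l₁ = l₂ = l₃`), and all
coefficient vectors `p, q`: the polynomial `(Σ_l p_l X^{d_l}) (Σ_l q_l X^{d_l}) + 1` has at most `3K − 3` dominant exponents, i.e.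
`npEdges ≤ 3K − 4`. [✓ `valAPFree_unfolded` on the `fg + 1` letters of ✓ `det_fgPencil`] -/
theorem npEdges_fg_add_one_le_of_apfree :
    ∀ (F : Type) [Field F] (v : AbsoluteValue F ℝ), IsNonarchimedean v → ∀ (K : ℕ) (d : Fin K → ℕ) (l₀ : Fin K), d l₀ = 0 →
      (∀ l₁ l₂ l₃ : Fin K, d l₁ + d l₂ = d l₃ + d l₃ → l₁ = l₃ ∧ l₂ = l₃) → ∀ (p q : Fin K → F),
        (((∑ l, C (p l) * (X : F[X]) ^ d l) * (∑ l, C (q l) * (X : F[X]) ^ d l) + 1).support.filter fun E =>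
            ∃ r : ℝ, 0 < r ∧ ∀ E' ∈ ((∑ l, C (p l) * (X : F[X]) ^ d l) * (∑ l, C (q l) * (X : F[X]) ^ d l) + 1).support, E' ≠ E →
              v (((∑ l, C (p l) * (X : F[X]) ^ d l) * (∑ l, C (q l) * (X : F[X]) ^ d l) + 1).coeff E') * r ^ E'
                < v (((∑ l, C (p l) * (X : F[X]) ^ d l) * (∑ l, C (q l) * (X : F[X]) ^ d l) + 1).coeff E) * r ^ E).card - 1
          ≤ 3 * K - 4 := by
  intro F _ v hv K d l₀ h0 hap p q
  have h := valAPFree_unfolded F v hv K d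
    (fun l => !![p l, if l = l₀ then (1 : F) else 0; if l = l₀ then (1 : F) else 0, -q l]) (fun l => fgLetter_isSymm p q l₀ l) hap
  rw [det_fgPencil d l₀ h0 p q, dominant_filter_neg] at h
  exact h

end Summit.ValiantsHypothesis.ValiantsHypothesis.Theorems.KPlusLogSqLaw.ValDoor
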